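import Literature.Probability.RandomPlanarGeometry.HexParafermion
import Literature.Probability.RandomPlanarGeometry.HexSAW

/-!
# Objects of the line `one-mouth-ball-reduction` for the crux `InteriorFlattening` (stmt-CriticalPhenomena-8297)

Lead prover `prover-line-stmt-CriticalPhenomena-8297-0` (crux protocol; skeleton
`Summits/CriticalPhenomena/SAWScalingLimit/Cruxes/InteriorFlattening/Lines/one_mouth_ball_reduction.lean`,
planner `planner-cruxplan-stmt-CriticalPhenomena-8297-one-mouth-ball-reduc-0`). This file only DEFINES the
finite combinatorial objects the line's six registered stubs speak about, so that the stub files under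
`Theorems/` and the lead's skeleton share ONE copy of them (the skeleton's block "The objects of the crux /
Last-entrance configurations" is byte-identical to the bodies below and is replaced by this import once the
module lands). No statement of the line is asserted or even named here.

The crux (M) = `…Theses.SAWDevelopingMap.InteriorFlattening`: bulk flattening of the Duminil-Copin–Smirnov
parafermionic observable `F = F(a, ·, x_c, 5/8)` of a simply connected hexagonal domain — the Beltrami mode
`‖F{v,w₀} + ωF{v,w₁} + ω²F{v,w₂}‖` is at most `ε` times the monopole `‖F{v,w₀} + F{v,w₁} + F{v,w₂}‖` at
every `R(ε)`-deep vertex. The line cuts every walk `a → {v, wᵢ}` at its LAST ENTRANCE into the lattice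
ball `S = B(v, r)`; the objects are:

* `xc`, `Fobs Λ a z` — the observable at `(x_c, 5/8)`; `omega = e^{2πi/3}`; `bel`, `mono` — the Beltrami
  mode and the monopole at `v` for a labelling `(w₀, w₁, w₂)` (literally the two sides of the crux);
* `zmass`, `pmass` — the `x_c`-masses majorising `‖F‖` at one mid-edge / at the three ports of `v`;
* `IsStar v w₀ w₁ w₂` — a labelling of the three neighbours; `Deep Λ v R` — the crux's ball hypothesis;
  `DepthFlat d k` — the crux matrix "quotient `≤ k` at depth `d`" (the crux is `∀ ε > 0, ∃ R, DepthFlat R ε`);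
* `ball Λ v r`, `entr Λ S` (entrance darts), `Config`, `Conf Λ S` (candidate one-mouth configurations
  `(D, (u, u'))`), `root c = {u, u'}`, `amp Λ a S c` (the far amplitude: coherent sum of `e^{-iσW} x_c^ℓ`
  over the outer pieces leaving exactly the inner domain `D` behind), `Clean S D v t` (no crosscut within
  `t` of `v`) with a fixed classical `Decidable` instance.

Plus ONE termwise API inequality, `norm_Fobs_le_zmass` (`‖F(z)‖ ≤ Σ_γ x_c^{ℓ(γ)}`), the registered sub-goal
this Defs file carries. Sources: H. Duminil-Copin, S. Smirnov, Ann. of Math. 175 (2012) 1653–1665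
(arXiv:1007.0575), §1–2 (walks between mid-edges, Definition 1); the line card
`Cruxes/InteriorFlattening/Lines/one-mouth-ball-reduction.md`. Deliberately NOT here: the six statements
(`LastEntranceFactorisation`, `OneMouthSimplyConnected`, `FarFieldCoherence`, `OneMouthBallFlattening`,
`ReentryArmSeparation`, `DeepBoundedDistortion`) and any theorem about them.
-/

noncomputable section

open scoped BigOperators
open Literature.Probability.LatticeModels Literature.Probability.RandomPlanarGeometry.SAW

namespace Summit.CriticalPhenomena.SAWScalingLimit.Theorems.InteriorFlattening.OneMouth

/-! ### The objects of the crux -/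

/-- `x_c = 1/√(2+√2)`, the critical fugacity of the hexagonal lattice (DCS 2012, §1). -/
abbrev xc : ℝ := hexCriticalFugacity

/-- The DCS observable at `(x_c, 5/8)` of the domain `Λ` with root `a`, at the mid-edge `z`
(DCS 2012, Definition 1). -/
def Fobs (Λ : Finset HexVertex) (a z : Sym2 HexVertex) : ℂ :=
  hexParafermionicObservable Λ a xc (5 / 8) z

/-- `ω = e^{2πi/3}` (literally the crux's `ω`). -/
def omega : ℂ := Complex.exp (2 * Real.pi * Complex.I / 3)

/-- The Beltrami mode at `v` for the labelling `(w₀, w₁, w₂)` (literally the crux's left side):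
`F{v,w₀} + ω F{v,w₁} + ω² F{v,w₂}`. -/
def bel (Λ : Finset HexVertex) (a : Sym2 HexVertex) (v w₀ w₁ w₂ : HexVertex) : ℂ :=
  Fobs Λ a s(v, w₀) + omega * Fobs Λ a s(v, w₁) + omega ^ 2 * Fobs Λ a s(v, w₂)

/-- The monopole at `v` (literally the crux's right side): `F{v,w₀} + F{v,w₁} + F{v,w₂}`. -/
def mono (Λ : Finset HexVertex) (a : Sym2 HexVertex) (v w₀ w₁ w₂ : HexVertex) : ℂ :=
  Fobs Λ a s(v, w₀) + Fobs Λ a s(v, w₁) + Fobs Λ a s(v, w₂)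

/-- The `x_c`-mass `Σ_γ x_c^{ℓ(γ)}` of the walks `a → z` (triangle-inequality majorant of `‖F(z)‖`). -/
def zmass (Λ : Finset HexVertex) (a z : Sym2 HexVertex) : ℝ :=
  ∑ γ : HexMidEdgeSAW Λ a z, xc ^ γ.length

/-- The `x_c`-mass arriving at the three ports of `v`. -/
def pmass (Λ : Finset HexVertex) (a : Sym2 HexVertex) (v w₀ w₁ w₂ : HexVertex) : ℝ :=
  zmass Λ a s(v, w₀) + zmass Λ a s(v, w₁) + zmass Λ a s(v, w₂)

/-- `(w₀, w₁, w₂)` is a labelling of the three neighbours of `v`: all adjacent to `v`, pairwise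
distinct (the crux's six hypotheses on `w₀ w₁ w₂`, bundled). -/
def IsStar (v w₀ w₁ w₂ : HexVertex) : Prop :=
  hexGraph.Adj v w₀ ∧ hexGraph.Adj v w₁ ∧ hexGraph.Adj v w₂ ∧ w₀ ≠ w₁ ∧ w₁ ≠ w₂ ∧ w₀ ≠ w₂

/-- `v` is `R`-deep in `Λ`: the Euclidean `R`-ball of lattice vertices around `v` lies in `Λ`
(the crux's ball hypothesis, verbatim). -/
def Deep (Λ : Finset HexVertex) (v : HexVertex) (R : ℝ) : Prop :=
  ∀ w : HexVertex, dist (hexCenter w) (hexCenter v) ≤ R → w ∈ Λ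

/-- `DepthFlat d k`: the crux matrix — at depth `d` the Beltrami quotient is at most `k`, uniformly
over simply connected domains, boundary roots, deep vertices and labellings. The crux is
`∀ ε > 0, ∃ R, DepthFlat R ε`. -/
def DepthFlat (d k : ℝ) : Prop :=
  ∀ Λ : Finset HexVertex, hexDomainSimplyConnected Λ → ∀ a ∈ hexDomainBoundary Λ, ∀ v ∈ Λ,
    Deep Λ v d → ∀ w₀ w₁ w₂ : HexVertex, IsStar v w₀ w₁ w₂ →
      ‖bel Λ a v w₀ w₁ w₂‖ ≤ k * ‖mono Λ a v w₀ w₁ w₂‖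

/-! ### Last-entrance configurations -/

/-- The lattice ball `B(v, r)` cut out of `Λ` (the full lattice ball as soon as `v` is `r`-deep). -/
def ball (Λ : Finset HexVertex) (v : HexVertex) (r : ℝ) : Finset HexVertex :=
  Λ.filter (fun w => dist (hexCenter w) (hexCenter v) ≤ r)

/-- Entrance darts of `S` inside `Λ`: ordered pairs `(u, u')`, `u ∈ Λ ∖ S`, `u' ∈ S`, `u ∼ u'`. -/
def entr (Λ S : Finset HexVertex) : Finset (HexVertex × HexVertex) :=
  (Λ ×ˢ S).filter (fun p => p.1 ∉ S ∧ hexGraph.Adj p.1 p.2)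

/-- A (candidate) ONE-MOUTH CONFIGURATION: an inner domain `D ⊆ S` and an entrance dart `(u, u')`. -/
abbrev Config : Type := Finset HexVertex × (HexVertex × HexVertex)

/-- All candidate configurations of `S` in `Λ` (a finite set; most carry amplitude `0`). -/
def Conf (Λ S : Finset HexVertex) : Finset Config := S.powerset ×ˢ entr Λ S

/-- The root mid-edge `{u, u'}` of a configuration. -/
def root (c : Config) : Sym2 HexVertex := s(c.2.1, c.2.2)

/-- The FAR AMPLITUDE of the configuration `c = (D, (u, u'))`: the coherent sum of
`e^{-iσW} x_c^ℓ` over the outer pieces `γ : a → {u, u'}` in `Λ` that end at the outer vertex `u`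
and leave exactly the inner domain `D = S ∖ γ` behind (all far sheets and far paths summed here). -/
def amp (Λ : Finset HexVertex) (a : Sym2 HexVertex) (S : Finset HexVertex) (c : Config) : ℂ :=
  ∑ γ : HexMidEdgeSAW Λ a s(c.2.1, c.2.2),
    if γ.verts.getLast? = some c.2.1 ∧ S \ γ.verts.toFinset = c.1 then γ.weight xc (5 / 8) else 0

/-- `Clean S D v t`: the configuration `(D, ·)` of `S` has NO crosscut within distance `t` of `v`
(its earlier excursions stay outside `B(v, t)`). -/
def Clean (S D : Finset HexVertex) (v : HexVertex) (t : ℝ) : Prop :=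
  ∀ w ∈ S, dist (hexCenter w) (hexCenter v) ≤ t → w ∈ D

/-- Classical decidability of `Clean`, fixed once so that every `Finset.filter` over it agrees. -/
instance Clean.instDecidable (S D : Finset HexVertex) (v : HexVertex) (t : ℝ) :
    Decidable (Clean S D v t) := Classical.dec _

/-! ### The one API inequality carried by this file -/

/-- `x_c ≥ 0`. -/
theorem xc_nonneg : 0 ≤ xc := hexCriticalFugacity_pos_lt_one.1.le

/-- **`‖F(z)‖ ≤ mass(z)`**: the observable at `(x_c, 5/8)` is bounded by the `x_c`-mass of the walks
(triangle inequality; the winding factors are unimodular). -/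
theorem norm_Fobs_le_zmass :
    ∀ (Λ : Finset HexVertex) (a z : Sym2 HexVertex), ‖Fobs Λ a z‖ ≤ zmass Λ a z :=
  fun Λ a z => norm_hexParafermionicObservable_le Λ a xc_nonneg _ z

end Summit.CriticalPhenomena.SAWScalingLimit.Theorems.InteriorFlattening.OneMouth

end
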